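import Summits.QuantumFields.BalabanUV.T4Continuum.Support.UrsellActivityNorm
import Summits.QuantumFields.BalabanUV.T4Continuum.Support.B13DomainGeometryTR

/-!
# NE5 ∕ U3 — the MODEL-FREE faces of leaf-08's parts 3 ∕ 5 ON THE CARRIERS ∕ SOCKET OF RECORD: the anchored exponential norm,
# and the summability ∕ per-domain budget of the combinatorial majorant, from a (2.38)-SHAPED polymer bound alone

Cell `pub-balaban`, unit `b2b-balaban-t4-ne5-formalise-leaf-02` (NE5 formalisation swarm, LEAF PROVER 02, gen 3; row O1-d1 holder —
`Support/B13StepTermLabels` p207773, `Support/B13StepTermSocket` p208148, `Support/B13InnerData` p208616), filed on the explicit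
offer of the natural holder leaf-08 (`CLAIMS.log` l.7450: *"NOT in my files — yours if you want them: the standalone named corollaries
`anchoredNorm_b13` … and `summable_actMajorant_b13` ∕ `tsum_actMajorant_le_b13`"*; my own INTENT l.7316 was WITHDRAWN as covered by
leaf-08's `UrsellActivityNorm` p210250 + `UrsellOfRecord` p210518).  Summits-side bookkeeping under the LEAN PLACEMENT RULE — three
corollaries BY NAME over landed theorems; NOT a Literature module.  HONEST FRAMING: rung (B)+1 of the FINITE-VOLUME T⁴ continuum
programme — NOT infinite volume, NOT a mass gap, NOT the Clay problem, NOT a proof of NE5.  HONEST DEPENDENCY (cell line, verbatim):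
continuum YM on T⁴ ⇐ BetaPertH ∧ nine spine estimates (0/9 proved); BetaPertH ⇐ (D1) ∧ (D4) ∧ CAP+tail; G-an2-4 gates asym, D1 and
NE2/3/4.

WHAT.  `UrsellOfRecord` (leaf-08, p210518) states the END points `TermRep` ∕ `ClassBound` on Bałaban's carriers of record
(`B13Carriers.TwoRuns.carriers`, p207668) from a (2.38)-SHAPED polymer bound.  A consumer holding only a `Summable (actMajorant …)` or a
per-domain budget binder (leaf-03's `hconv` in `B13TermHistSecant` ∕ `B13StepSecantEnd`, leaf-04's levelwise currency) wants the
intermediate, MODEL-FREE statements by name.  Here they are, for ANY inner data `D : InnerData R.carriers Bd` on the geometry of record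
`B13DomainGeometryTR.domainGeometry R`, every geometric input being a THEOREM of the torus geometry (P2 p208152):
* `anchoredNorm_b13` — `UrsellActivityNorm.anchoredNorm_of_ineq126` with (1.26) ∕ (2.30) DISCHARGED by `ineq126_level` ∕ `volBound_level`
  (κ₀ = 64·log 162, K₀ = K₀(64,8), c₁ = 64): `∀ q, Σ_{Z ∈ R.domAt k} 𝟙(q ∈ footprint Z)·w Z·e^{#footprint Z} ≤ ε·e^{64}·K₀(64,8)` from
  `w ≤ ε·e^{−Rt·d}` on `R.domAt k` and `64·log 162 + 64 ≤ Rt`;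
* `summable_actMajorant_b13`, `tsum_actMajorant_le_b13` — leaf-08's part 3 (`UrsellTermBudget.summable_actMajorant` ∕ `tsum_actMajorant_le`,
  p209547) with `hloc` ∕ `hreach` ∕ `hΦ` DISCHARGED by `loc_b13` ∕ `reach_b13` (ν = 9) ∕ `anchoredNorm_b13`: from `𝒜 ≥ 0`, the (2.38) SHAPE
  `actSum D 𝒜 k Z ≤ ε·e^{−Rt·d(Z)}` on `R.domAt k` (*"|H(Z)| ≤ C₃ε₁exp(−(1 − 8δ)½Lκd_{k+1}(Z))"*, [Balaban1988RG2Cluster] Lemma 3 (2.38)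
  p. 20 — a hypothesis SHAPE on a parametrised majorant, asserted nowhere, c4), `64·log 162 + 64 ≤ Rt` and `4·9·Φ₀ < 1`,
  `Φ₀ = ε·e^{64}·K₀(64,8)`: `Summable (actMajorant (labelsIndexing (domainGeometry R) D) (touchInc (domainGeometry R)) 𝒜 k X)` and
  `∑' ≤ Φ₀∕(1 − 4·9·Φ₀)` at every domain `X`.
No definitions; 0 sorry; axioms ⊆ {propext, Classical.choice, Quot.sound}.
-/

noncomputable section

open scoped BigOperators

namespace Summit.QuantumFields.BalabanUV.T4Continuum.UrsellOfRecordFaces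

open Literature.MathematicalPhysics.QuantumFieldTheory.Balaban1983to89
open Summit.QuantumFields.BalabanUV.T4Continuum.B13Carriers (TwoRuns)
open Summit.QuantumFields.BalabanUV.T4Continuum.B13StepTermLabels (InnerLabel InnerData)
open Summit.QuantumFields.BalabanUV.T4Continuum.B13StepTermSocket (labelsIndexing touchInc)
open Summit.QuantumFields.BalabanUV.T4Continuum.B13TermRep (actMajorant)
open Summit.QuantumFields.BalabanUV.T4Continuum.B13DomainGeometryTR (SCube footprint domainGeometry reach loc_b13 reach_b13
  ineq126_level volBound_level)
open Summit.QuantumFields.BalabanUV.T4Continuum.UrsellTreeSum (ind)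
open Summit.QuantumFields.BalabanUV.T4Continuum.UrsellTermBudget (actSum summable_actMajorant tsum_actMajorant_le)
open Summit.QuantumFields.BalabanUV.T4Continuum.UrsellActivityNorm (anchoredNorm_of_ineq126)

variable {G : Type} [GaugeGroup G] (R : TwoRuns G)

/-- **THE ANCHORED EXPONENTIAL NORM ON BAŁABAN's CARRIERS OF RECORD** (every creation step `k`, every anchoring sigma-cube `q`): a
(2.38)-shaped bound `w Z ≤ ε·e^{−Rt·d(Z)}` on the catalogue `R.domAt k` and the rate room `64·log 162 + 64 ≤ Rt` give
`Σ_{Z ∈ R.domAt k} 𝟙(q ∈ footprint Z)·w Z·e^{#footprint Z} ≤ ε·e^{64}·K₀(64,8)` — leaf-08's `anchoredNorm_of_ineq126` with (1.26) and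
(2.30) the THEOREMS `B13DomainGeometryTR.ineq126_level` ∕ `volBound_level`. -/
theorem anchoredNorm_b13 {k : ℕ} {w : R.carriers.Dom → ℝ} {ε Rt : ℝ} (hε : 0 ≤ ε)
    (hw : ∀ Z ∈ R.domAt k, w Z ≤ ε * Real.exp (-(Rt * R.carriers.d Z))) (hR : 64 * Real.log 162 + 64 ≤ Rt) (q : SCube R) :
    ∑ Z ∈ R.domAt k, ind (q ∈ footprint Z) * w Z * Real.exp ((footprint Z).card) ≤
      ε * Real.exp 64 * B12TreeDecay.K₀ (4 * 2 ^ 4) (2 * 4) :=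
  anchoredNorm_of_ineq126 (domainGeometry R) hε hw (ineq126_level k) (volBound_level k) hR q

/-- [folklore] The constant of record `ε·e^{64}·K₀(64,8)` is nonnegative for `ε ≥ 0`. -/
theorem phi_nonneg {ε : ℝ} (hε : 0 ≤ ε) : 0 ≤ ε * Real.exp 64 * B12TreeDecay.K₀ (4 * 2 ^ 4) (2 * 4) :=
  mul_nonneg (mul_nonneg hε (Real.exp_nonneg _)) (B12TreeDecay.K₀_pos _ _).le

variable {Bd : Type*} [DecidableEq Bd] (D : InnerData R.carriers Bd)

/-- **SUMMABILITY OF THE COMBINATORIAL MAJORANT ON THE SOCKET OF RECORD FROM THE (2.38) SHAPE** (model-free): for a nonnegative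
per-label majorant `𝒜` whose polymer sums obey `actSum D 𝒜 k Z ≤ ε·e^{−Rt·d(Z)}` on `R.domAt k` ([Balaban1988RG2Cluster] Lemma 3 (2.38)
p. 20 — hypothesis SHAPE), with `64·log 162 + 64 ≤ Rt` and `4·9·(ε·e^{64}·K₀(64,8)) < 1`, leaf-04's `actMajorant` on
`labelsIndexing (domainGeometry R) D` ∕ `touchInc (domainGeometry R)` is summable at every domain — leaf-08's `summable_actMajorant` with
`hloc` ∕ `hreach` ∕ `hΦ` DISCHARGED (`loc_b13`, `reach_b13`, `anchoredNorm_b13`). -/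
theorem summable_actMajorant_b13 (𝒜 : R.carriers.Dom → InnerLabel R.carriers.Dom Bd → ℝ) {ε Rt : ℝ} {k : ℕ}
    (h𝒜 : ∀ Z ℓ, 0 ≤ 𝒜 Z ℓ) (hε : 0 ≤ ε)
    (h238 : ∀ Z ∈ R.domAt k, actSum D 𝒜 k Z ≤ ε * Real.exp (-(Rt * R.carriers.d Z)))
    (hR : 64 * Real.log 162 + 64 ≤ Rt) (hsmall : 4 * 9 * (ε * Real.exp 64 * B12TreeDecay.K₀ (4 * 2 ^ 4) (2 * 4)) < 1)
    (X : R.carriers.Dom) :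
    Summable (actMajorant (labelsIndexing (domainGeometry R) D) (touchInc (domainGeometry R)) 𝒜 k X) :=
  summable_actMajorant (domainGeometry R) D 𝒜 reach h𝒜 (fun Z Z' h => loc_b13 Z Z' h) (by norm_num) reach_b13 (phi_nonneg hε)
    hsmall (anchoredNorm_b13 R hε h238 hR) X

/-- **THE PER-DOMAIN BUDGET ON THE SOCKET OF RECORD FROM THE (2.38) SHAPE** (model-free, decay rate 0):
`∑' i, actMajorant … 𝒜 k X i ≤ Φ₀∕(1 − 4·9·Φ₀)`, `Φ₀ = ε·e^{64}·K₀(64,8)` — leaf-08's `tsum_actMajorant_le` with `hloc` ∕ `hreach` ∕ `hΦ`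
DISCHARGED.  (The rate `κ > 0` and the END points `TermRep` ∕ `ClassBound` are `UrsellOfRecord`'s, p210518.) -/
theorem tsum_actMajorant_le_b13 (𝒜 : R.carriers.Dom → InnerLabel R.carriers.Dom Bd → ℝ) {ε Rt : ℝ} {k : ℕ}
    (h𝒜 : ∀ Z ℓ, 0 ≤ 𝒜 Z ℓ) (hε : 0 ≤ ε)
    (h238 : ∀ Z ∈ R.domAt k, actSum D 𝒜 k Z ≤ ε * Real.exp (-(Rt * R.carriers.d Z)))
    (hR : 64 * Real.log 162 + 64 ≤ Rt) (hsmall : 4 * 9 * (ε * Real.exp 64 * B12TreeDecay.K₀ (4 * 2 ^ 4) (2 * 4)) < 1)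
    (X : R.carriers.Dom) :
    ∑' i, actMajorant (labelsIndexing (domainGeometry R) D) (touchInc (domainGeometry R)) 𝒜 k X i ≤
      ε * Real.exp 64 * B12TreeDecay.K₀ (4 * 2 ^ 4) (2 * 4) /
        (1 - 4 * 9 * (ε * Real.exp 64 * B12TreeDecay.K₀ (4 * 2 ^ 4) (2 * 4))) :=
  tsum_actMajorant_le (domainGeometry R) D 𝒜 reach h𝒜 (fun Z Z' h => loc_b13 Z Z' h) (by norm_num) reach_b13 (phi_nonneg hε)
    hsmall (anchoredNorm_b13 R hε h238 hR) X

end Summit.QuantumFields.BalabanUV.T4Continuum.UrsellOfRecordFaces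

end
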